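import Mathlib
import Summits.ValiantsHypothesis.ValiantsHypothesis.Theorems.RigidityForcesSymmetryRankRigidMinimalReprLaplaceFiveStarTwoTermReading
import Summits.ValiantsHypothesis.ValiantsHypothesis.Theorems.RigidityForcesSymmetryRankRigidMinimalReprLaplaceFiveStarLemmaTwoPrime

/-!
# ValiantsHypothesis / RigidityForcesSymmetry — crux `LaplaceOptimalFive` (stmt-ValiantsHypothesis-24813), crux idea
`young-shadow` (K1) on the star: **A STAR SPLIT CARRYING TWO TERMS — WEIGHT ≥ 120, OR THE T1/T2 DATA OF LEMMA 2′**
(memo `NOTE-p4g16-24813-LemmaK-kernel.md` §2 (L3-i/ii); memo `NOTE-p4g15-24813-K1-star.md` §6/§9)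

Chains ✓ `two_term_reading` (decomposition ⟹ letter currency) with ✓ `lemma_two_prime` (LEMMA K twice) and disposes of every
degenerate branch by LEMMA 1 (✓ `rankOne_closed`): if the two short factors are proportional, or one of the two cubics vanishes, the
shadow is ONE closed product, hence fully symmetric (✓ `full_of_crossSwap`), hence the decomposition weighs `≥ 120`
(✓ `sideSym_star_of_symmetric_shadow`).  What survives (`two_term_split`): independent `U₁, U₂` with EITHER the T2 data (binary
pencil `⊂ Sym²⟨e,f⟩`, both long factors in `Sym³⟨e,f⟩`) OR the T1 data (square member `λλᵀ`, both cubics in `L·⟨Q₁,Q₂⟩`).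

Also: `cubic_tensor_eq_zero`, `weight_of_closed_product`.  No definitions, no `sorry`.  Honest framing: (L3) plumbing, closes nothing;
the cross-split count and (L1) remain; K1-on-the-star PAPER PASS, not kernel; `LaplaceOptimalFive` OPEN · CONTESTED 72/120;
`VP ≠ VNP` NOT proved.
-/

set_option linter.dupNamespace false

namespace Summit.ValiantsHypothesis.ValiantsHypothesis.Theorems.RigidityForcesSymmetryRankRigidMinimalRepr

namespace LaplaceFiveStar

open Finset MvPolynomial LaplaceFiveSectorSplit

/-- A symmetric cubic tensor whose cubic form vanishes as a POLYNOMIAL is zero. [folklore] -/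
theorem cubic_tensor_eq_zero (W : Fin 5 → Fin 5 → Fin 5 → ℂ)
    (hWa : ∀ a b c : Fin 5, W a b c = W b a c) (hWb : ∀ a b c : Fin 5, W a b c = W a c b)
    (h : (∑ a : Fin 5, ∑ b : Fin 5, ∑ c : Fin 5, C (W a b c) * X a * X b * X c : MvPolynomial (Fin 5) ℂ) = 0)
    (a b c : Fin 5) : W a b c = 0 := by
  have h1 := congr_arg (pderiv a) h
  rw [pderiv_cubic, map_zero] at h1
  have perm : ∀ x y : Fin 5, W x a y = W a x y ∧ W x y a = W a x y ∧ W a y x = W a x y ∧ W y a x = W a x y ∧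
      W y x a = W a x y := by
    intro x y
    have p1 : W x a y = W a x y := (hWa a x y).symm
    have p2 : W x y a = W a x y := by rw [← hWb x a y]; exact p1
    have p3 : W a y x = W a x y := (hWb a x y).symm
    have p4 : W y a x = W a x y := by rw [← hWa a y x]; exact p3
    have p5 : W y x a = W a x y := by rw [← hWb y a x]; exact p4
    exact ⟨p1, p2, p3, p4, p5⟩
  have hS : ∀ x y : Fin 5, W a x y + W x a y + W x y a = W a y x + W y a x + W y x a := by
    intro x y
    obtain ⟨p1, p2, p3, p4, p5⟩ := perm x y
    rw [p1, p2, p3, p4, p5]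
  have h3 := quadric_tensor_eq_zero (fun x y => W a x y + W x a y + W x y a) hS h1 b c
  have e : W a b c + W b a c + W b c a = 3 * W a b c := by
    obtain ⟨p1, p2, -, -, -⟩ := perm b c
    rw [p1, p2]
    ring
  have h4 : 3 * W a b c = 0 := by rw [← e]; exact h3
  exact (mul_eq_zero.mp h4).resolve_left three_ne_zero

variable {N : ℕ}

/-- **One closed product on a star split forces weight `≥ 120`** (LEMMA 1 in decomposition currency, generalising
✓ `sideSym_starPairSplits_of_lone_term` from «one term» to «shadow = one product of symmetric letter functions satisfying `(C)`»). [folklore] -/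
theorem weight_of_closed_product (T : Finset (Fin N)) (S : Fin N → Finset (Fin 5))
    (u w : Fin N → (Fin 5 → Fin 5) → ℂ) (hdec : IsSplitDecomposition T S u w) (hsym : SideSymmetric T S u w)
    (hpair : ∀ t ∈ T, (S t).card = 2) (hstar : ∃ c : Fin 5, ∀ A ∈ T.image S, c ∈ A)
    (A₀ : Finset (Fin 5)) (hA₀ : A₀ ∈ T.image S) (p a b c d : Fin 5) (hpa : p ≠ a) (hpb : p ≠ b) (hab : a ≠ b)
    (hac : a ≠ c) (had : a ≠ d) (hbc : b ≠ c) (hbd : b ≠ d)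
    (hA₀e : A₀ = {p, a}) (U : Fin 5 → Fin 5 → ℂ) (W : Fin 5 → Fin 5 → Fin 5 → ℂ)
    (hU : ∀ x y : Fin 5, U x y = U y x) (hW1 : ∀ x y z : Fin 5, W x y z = W y x z) (hW2 : ∀ x y z : Fin 5, W x y z = W x z y)
    (hC : ∀ A B C D E : Fin 5, U A C * W B D E + U A D * W B C E + U A E * W B C D
      = U B C * W A D E + U B D * W A C E + U B E * W A C D)
    (hshadow : ∀ v : Fin 5 → Fin 5, (∑ t ∈ T.filter (fun t => S t = A₀), u t v * w t v) = U (v p) (v a) * W (v b) (v c) (v d)) :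
    Nat.factorial 5 ≤ laplaceWeight T S := by
  classical
  refine sideSym_star_of_symmetric_shadow N T S u w hdec hsym hpair hstar A₀ hA₀ ?_
  obtain ⟨hu, hw, -⟩ := hdec
  have hZ₀ : SlotInvariantOn A₀ (fun v => ∑ t ∈ T.filter (fun t => S t = A₀), u t v * w t v) ∧
      SlotInvariantOn A₀ᶜ (fun v => ∑ t ∈ T.filter (fun t => S t = A₀), u t v * w t v) :=
    ⟨fun τ hτ v => LaplaceFiveTriangleSeparation.shadow_inv_left T S u w hw hsym A₀ τ hτ v,
      fun τ hτ v => LaplaceFiveTriangleSeparation.shadow_inv_right T S u w hu hsym A₀ τ hτ v⟩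
  have hG := rankOne_closed U W hU hW1 hW2 hC
  have hinv : InvUnder (Equiv.swap a b) (fun v => ∑ t ∈ T.filter (fun t => S t = A₀), u t v * w t v) := by
    intro v
    show (∑ t ∈ T.filter (fun t => S t = A₀), u t (v ∘ ⇑(Equiv.swap a b)) * w t (v ∘ ⇑(Equiv.swap a b)))
      = ∑ t ∈ T.filter (fun t => S t = A₀), u t v * w t v
    rw [hshadow, hshadow]
    simp only [Function.comp_apply, Equiv.swap_apply_left, Equiv.swap_apply_right,
      Equiv.swap_apply_of_ne_of_ne hpa hpb, Equiv.swap_apply_of_ne_of_ne (Ne.symm hac) (Ne.symm hbc),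
      Equiv.swap_apply_of_ne_of_ne (Ne.symm had) (Ne.symm hbd)]
    exact hG (v p) (v b) (v a) (v c) (v d)
  exact full_of_crossSwap (S := A₀) hZ₀.1 hZ₀.2 (c := a) (d := b) (by rw [hA₀e]; simp)
    (by rw [hA₀e]; simp [Ne.symm hpb, Ne.symm hab]) hinv

/-- **A star split carrying exactly two terms: weight `≥ 120`, or the T1/T2 data.**  With the letter tensors of ✓ `two_term_reading`:
if `U₁ ∥ U₂` or one cubic vanishes, the shadow is one closed product and ✓ `weight_of_closed_product` gives `120`; otherwise
✓ `lemma_two_prime` leaves the binary (T2) or square-member (T1) data, recorded verbatim. [folklore] -/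
theorem two_term_split (T : Finset (Fin N)) (S : Fin N → Finset (Fin 5))
    (u w : Fin N → (Fin 5 → Fin 5) → ℂ) (hdec : IsSplitDecomposition T S u w) (hsym : SideSymmetric T S u w)
    (hpair : ∀ t ∈ T, (S t).card = 2) (h4 : (T.image S).card = 4) (hstar : ∃ c : Fin 5, ∀ A ∈ T.image S, c ∈ A)
    (A₀ : Finset (Fin 5)) (hA₀ : A₀ ∈ T.image S) (htwo : (T.filter (fun t => S t = A₀)).card = 2) :
    Nat.factorial 5 ≤ laplaceWeight T S ∨
    ∃ p a b c d : Fin 5, p ≠ a ∧ p ≠ b ∧ p ≠ c ∧ p ≠ d ∧ a ≠ b ∧ a ≠ c ∧ a ≠ d ∧ b ≠ c ∧ b ≠ d ∧ c ≠ d ∧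
      A₀ = {p, a} ∧ T.image S = {({p, a} : Finset (Fin 5)), {p, b}, {p, c}, {p, d}} ∧
    ∃ t₁ t₂ : Fin N, t₁ ≠ t₂ ∧ T.filter (fun t => S t = A₀) = {t₁, t₂} ∧
    ∃ (U₁ U₂ : Fin 5 → Fin 5 → ℂ) (W₁ W₂ : Fin 5 → Fin 5 → Fin 5 → ℂ),
      (∀ v : Fin 5 → Fin 5, (∑ t ∈ T.filter (fun t => S t = A₀), u t v * w t v)
        = U₁ (v p) (v a) * W₁ (v b) (v c) (v d) + U₂ (v p) (v a) * W₂ (v b) (v c) (v d)) ∧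
      (∀ v : Fin 5 → Fin 5, u t₁ v = U₁ (v p) (v a)) ∧ (∀ v : Fin 5 → Fin 5, w t₁ v = W₁ (v b) (v c) (v d)) ∧
      (∀ v : Fin 5 → Fin 5, u t₂ v = U₂ (v p) (v a)) ∧ (∀ v : Fin 5 → Fin 5, w t₂ v = W₂ (v b) (v c) (v d)) ∧
      (∀ x y : Fin 5, U₁ x y = U₁ y x) ∧ (∀ x y : Fin 5, U₂ x y = U₂ y x) ∧
      (∀ x y z : Fin 5, W₁ x y z = W₁ y x z) ∧ (∀ x y z : Fin 5, W₁ x y z = W₁ x z y) ∧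
      (∀ x y z : Fin 5, W₂ x y z = W₂ y x z) ∧ (∀ x y z : Fin 5, W₂ x y z = W₂ x z y) ∧
      (∀ A B C D E : Fin 5,
        (U₁ A C * W₁ B D E + U₁ A D * W₁ B C E + U₁ A E * W₁ B C D)
          + (U₂ A C * W₂ B D E + U₂ A D * W₂ B C E + U₂ A E * W₂ B C D)
        = (U₁ B C * W₁ A D E + U₁ B D * W₁ A C E + U₁ B E * W₁ A C D)
          + (U₂ B C * W₂ A D E + U₂ B D * W₂ A C E + U₂ B E * W₂ A C D)) ∧
      (∀ s t : ℂ, (∀ x y : Fin 5, s * U₁ x y + t * U₂ x y = 0) → s = 0 ∧ t = 0) ∧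
      ((∃ e f : Fin 5 → ℂ,
          (∀ d' : Fin 5, (∃ s t : ℂ, ∀ x : Fin 5, U₁ x d' = s * e x + t * f x) ∧
            (∃ s t : ℂ, ∀ x : Fin 5, U₂ x d' = s * e x + t * f x)) ∧
          (∀ v : Fin 5 → ℂ, ∑ x : Fin 5, v x * e x = 0 → ∑ x : Fin 5, v x * f x = 0 →
            ∀ b' c' : Fin 5, ∑ a' : Fin 5, v a' * W₁ a' b' c' = 0) ∧
          (∀ v : Fin 5 → ℂ, ∑ x : Fin 5, v x * e x = 0 → ∑ x : Fin 5, v x * f x = 0 →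
            ∀ b' c' : Fin 5, ∑ a' : Fin 5, v a' * W₂ a' b' c' = 0)) ∨
        (∃ lam : Fin 5 → ℂ, ∃ s t : ℂ, (s ≠ 0 ∨ t ≠ 0) ∧ (∀ x y : Fin 5, s * U₁ x y + t * U₂ x y = lam x * lam y) ∧
          (∃ c₁ c₂ : ℂ, (∑ i : Fin 5, ∑ j : Fin 5, ∑ l : Fin 5, C (W₁ i j l) * X i * X j * X l : MvPolynomial (Fin 5) ℂ)
            = (∑ z : Fin 5, lam z • (X z : MvPolynomial (Fin 5) ℂ)) *
              (C c₁ * (∑ i : Fin 5, ∑ j : Fin 5, C (U₁ i j) * X i * X j) + C c₂ * (∑ i : Fin 5, ∑ j : Fin 5, C (U₂ i j) * X i * X j))) ∧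
          (∃ c₁ c₂ : ℂ, (∑ i : Fin 5, ∑ j : Fin 5, ∑ l : Fin 5, C (W₂ i j l) * X i * X j * X l : MvPolynomial (Fin 5) ℂ)
            = (∑ z : Fin 5, lam z • (X z : MvPolynomial (Fin 5) ℂ)) *
              (C c₁ * (∑ i : Fin 5, ∑ j : Fin 5, C (U₁ i j) * X i * X j) + C c₂ * (∑ i : Fin 5, ∑ j : Fin 5, C (U₂ i j) * X i * X j))))) := by
  classical
  obtain ⟨p, a, b, c, d, hpa, hpb, hpc, hpd, hab, hac, had, hbc, hbd, hcd, hA₀e, himage, t₁, t₂, ht12, ht, U₁, U₂, W₁, W₂,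
    hshadow, hF1, hF2, hF3, hF4, hU1s, hU2s, hW1a, hW1b, hW2a, hW2b, hC⟩ :=
    two_term_reading T S u w hdec hsym hpair h4 hstar A₀ hA₀ htwo
  -- one closed product ⟹ 120
  have closed_product : ∀ (U : Fin 5 → Fin 5 → ℂ) (W : Fin 5 → Fin 5 → Fin 5 → ℂ),
      (∀ x y : Fin 5, U x y = U y x) → (∀ x y z : Fin 5, W x y z = W y x z) → (∀ x y z : Fin 5, W x y z = W x z y) →
      (∀ A B C D E : Fin 5, U A C * W B D E + U A D * W B C E + U A E * W B C D
        = U B C * W A D E + U B D * W A C E + U B E * W A C D) →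
      (∀ v : Fin 5 → Fin 5, (∑ t ∈ T.filter (fun t => S t = A₀), u t v * w t v) = U (v p) (v a) * W (v b) (v c) (v d)) →
      Nat.factorial 5 ≤ laplaceWeight T S :=
    fun U W hU hW1 hW2 hC' hsh => weight_of_closed_product T S u w hdec hsym hpair hstar A₀ hA₀ p a b c d hpa hpb hab hac had
      hbc hbd hA₀e U W hU hW1 hW2 hC' hsh
  by_cases hind : ∀ s t : ℂ, (∀ x y : Fin 5, s * U₁ x y + t * U₂ x y = 0) → s = 0 ∧ t = 0
  · rcases lemma_two_prime U₁ U₂ W₁ W₂ hU1s hU2s hW1a hW1b hW2a hW2b hind hC _ _ _ _ rfl rfl rfl rfl with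
      hT2 | hT1 | hK1 | hK2
    · exact Or.inr ⟨p, a, b, c, d, hpa, hpb, hpc, hpd, hab, hac, had, hbc, hbd, hcd, hA₀e, himage, t₁, t₂, ht12, ht,
        U₁, U₂, W₁, W₂, hshadow, hF1, hF2, hF3, hF4, hU1s, hU2s, hW1a, hW1b, hW2a, hW2b, hC, hind, Or.inl hT2⟩
    · exact Or.inr ⟨p, a, b, c, d, hpa, hpb, hpc, hpd, hab, hac, had, hbc, hbd, hcd, hA₀e, himage, t₁, t₂, ht12, ht,
        U₁, U₂, W₁, W₂, hshadow, hF1, hF2, hF3, hF4, hU1s, hU2s, hW1a, hW1b, hW2a, hW2b, hC, hind, Or.inr hT1⟩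
    · -- `K₁ = 0`: `W₁ = 0`, the shadow is the closed product `U₂ ⊗ W₂`
      have hW10 : ∀ x y z : Fin 5, W₁ x y z = 0 := cubic_tensor_eq_zero W₁ hW1a hW1b hK1
      refine Or.inl (closed_product U₂ W₂ hU2s hW2a hW2b (fun A B C D E => ?_) fun v => ?_)
      · have h := hC A B C D E
        simp only [hW10, mul_zero, zero_add, add_zero] at h
        exact h
      · rw [hshadow v, hW10, mul_zero, zero_add]
    · have hW20 : ∀ x y z : Fin 5, W₂ x y z = 0 := cubic_tensor_eq_zero W₂ hW2a hW2b hK2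
      refine Or.inl (closed_product U₁ W₁ hU1s hW1a hW1b (fun A B C D E => ?_) fun v => ?_)
      · have h := hC A B C D E
        simp only [hW20, mul_zero, add_zero] at h
        exact h
      · rw [hshadow v, hW20, mul_zero, add_zero]
  · -- `U₁ ∥ U₂`: one closed product again
    left
    simp only [not_forall] at hind
    obtain ⟨s, t, hst0, hst⟩ := hind
    by_cases hs : s = 0
    · -- `t ≠ 0`, `U₂ = 0`
      have ht : t ≠ 0 := fun h => hst ⟨hs, h⟩
      have hU20 : ∀ x y : Fin 5, U₂ x y = 0 := fun x y => by
        have h := hst0 x y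
        rw [hs, zero_mul, zero_add] at h
        exact (mul_eq_zero.mp h).resolve_left ht
      refine closed_product U₁ W₁ hU1s hW1a hW1b (fun A B C D E => ?_) fun v => ?_
      · have h := hC A B C D E
        simp only [hU20, zero_mul, add_zero] at h
        exact h
      · rw [hshadow v, hU20, zero_mul, add_zero]
    · -- `U₁ = −(t/s) U₂`: shadow `= U₂ ⊗ (W₂ − (t/s) W₁)`
      have hU1e : ∀ x y : Fin 5, U₁ x y = -(t / s) * U₂ x y := fun x y => by
        have h := hst0 x y
        field_simp
        linear_combination h
      refine closed_product U₂ (fun x y z => W₂ x y z - t / s * W₁ x y z) hU2s (fun x y z => ?_) (fun x y z => ?_)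
        (fun A B C D E => ?_) fun v => ?_
      · show W₂ x y z - t / s * W₁ x y z = W₂ y x z - t / s * W₁ y x z
        rw [hW2a x y z, hW1a x y z]
      · show W₂ x y z - t / s * W₁ x y z = W₂ x z y - t / s * W₁ x z y
        rw [hW2b x y z, hW1b x y z]
      · have h := hC A B C D E
        simp only [hU1e] at h
        linear_combination h
      · rw [hshadow v, hU1e]
        ring

end LaplaceFiveStar

end Summit.ValiantsHypothesis.ValiantsHypothesis.Theorems.RigidityForcesSymmetryRankRigidMinimalRepr
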